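import Summits.KontsevichZagierPeriods.KontsevichZagierPeriods.Theorems.RootDecompZetaThreeFrontierWordRungTwoP6

/-! # `RootDecompZetaThreeFrontierWordRungTwoP7` — part 7/12 of the mechanical ≤270-line split of `RungTwo.stripped.lean`
(split by the decomp-kz census seat for landing; mathematics unchanged; part 7 continues part 6). -/

noncomputable section

namespace Summit.KontsevichZagierPeriods.RootDecompZetaThreeFrontier.WordLayer
open Set MeasureTheory MvPolynomial
open Literature.NumberTheory.Transcendental
open Summit.KontsevichZagierPeriods.KontsevichZagierPeriods.Theses.RootDecompZetaThreeFrontier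
  (HigherWeightDescent)
open Summit.KontsevichZagierPeriods.KontsevichZagierPeriods.Theses.LinRedNormalForm
  (DihedralNormalForm MzvKernelInKZ HoffmanSpanInKZ HoffmanIndependence)

section CornerClassesAll
open Literature.ModelTheory.ExponentialFields (IsSemialgebraic)













/-! (private copy of `strictAnti_fin_one` — dedup.landed / split policy; origin part RootDecompZetaThreeFrontierWordRungTwoP1) -/
/-- Auxiliary step `strictAnti_fin_one`. [bookkeeping] -/
private theorem strictAnti_fin_one (y : Fin 1 → ℝ) : StrictAnti y := fun a b hab =>
  absurd hab (by rw [Subsingleton.elim a b]; exact lt_irrefl _)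

/-! (private copy of `mem_simplex_one_iff` — dedup.landed / split policy; origin part RootDecompZetaThreeFrontierWordRungTwoP1) -/
/-- Membership in `simplex_one_iff`, unfolded. [bookkeeping] -/
private theorem mem_simplex_one_iff (y : Fin 1 → ℝ) : y ∈ KZ.openOrderedSimplex 1 ↔ 0 < y 0 ∧ y 0 < 1 := by
  constructor
  · rintro ⟨h0, h1, -⟩
    exact ⟨h0 0, h1 0⟩
  · rintro ⟨h0, h1⟩
    refine ⟨fun i => ?_, fun i => ?_, strictAnti_fin_one y⟩
    · rw [Fin.fin_one_eq_zero i]; exact h0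
    · rw [Fin.fin_one_eq_zero i]; exact h1

/-! (private copy of `mem_simplex_two_iff` — dedup.landed / split policy; origin part RootDecompZetaThreeFrontierWordRungTwoP1) -/
/-- Membership in `simplex_two_iff`, unfolded. [bookkeeping] -/
private theorem mem_simplex_two_iff (z : Fin 2 → ℝ) :
    z ∈ KZ.openOrderedSimplex 2 ↔ 0 < z 1 ∧ z 1 < z 0 ∧ z 0 < 1 := by
  constructor
  · rintro ⟨h0, h1, ha⟩
    exact ⟨h0 1, ha (show (0 : Fin 2) < 1 by decide), h1 0⟩
  · rintro ⟨h1, h10, h0⟩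
    refine ⟨Fin.forall_fin_two.mpr ⟨h1.trans h10, h1⟩, Fin.forall_fin_two.mpr ⟨h0, h10.trans h0⟩,
      Fin.strictAnti_iff_succ_lt.mpr (Fin.forall_fin_one.mpr ?_)⟩
    simpa using h10

/-- **the two-term `γ`-step**: if every class `q'·C(j,k;β,g+1)` lies in the span, so does `q·C(j,k;β,g+2)` (`g+2 ≤ k+1`, `β ≤ j+1`). -/
theorem cc_gamma_step (q : ℚ) {j k β g : ℕ} (hj : β ≤ j + 1) (hk : g + 2 ≤ k + 1)
    (ih : ∀ (q' : ℚ) (r : KZ.IntegralRep 2), r.domain = KZ.openOrderedSimplex 2 →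
      EqOn r.integrand (fun z => (q' : ℝ) * cc j k β (g + 1) z) r.domain →
      ∃ m ∈ AddSubgroup.closure (wordGensLE 2), KZ.of r - m ∈ KZ.relations)
    (r : KZ.IntegralRep 2) (hd : r.domain = KZ.openOrderedSimplex 2)
    (hi : EqOn r.integrand (fun z => (q : ℝ) * cc j k β (g + 2) z) r.domain) :
    ∃ m ∈ AddSubgroup.closure (wordGensLE 2), KZ.of r - m ∈ KZ.relations := by
  have hg1 : g + 1 ≤ k + 1 := by omega
  set c : ℚ := q * ((j : ℚ) - g) / ((g : ℚ) + 1) with hc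
  set Q : ℚ := q / ((g : ℚ) + 1) with hQ
  -- the split `f = q·C(j,k;β,g+2) + c·C(j,k;β,g+1)` (rule 1b; all three pieces absolutely convergent)
  have hf_sa : IsSemialgebraicFunOn ℚ (KZ.openOrderedSimplex 2)
      (fun z => (q : ℝ) * cc j k β (g + 2) z + (c : ℝ) * cc j k β (g + 1) z) :=
    IsSemialgebraicFunOn.add_holds (cc_sa q j k β (g + 2)) (cc_sa c j k β (g + 1))
  have hf_int : IntegrableOn (fun z => (q : ℝ) * cc j k β (g + 2) z + (c : ℝ) * cc j k β (g + 1) z)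
      (KZ.openOrderedSimplex 2) :=
    (cc_integrableOn q hj hk).add (cc_integrableOn c hj hg1)
  refine of_sub_split r (repTwo _ hf_sa hf_int) (ccRep c j k β (g + 1) hj hg1) hd rfl rfl
    (fun z hz => by rw [hi (by rw [hd]; exact hz)]; rfl) ?_ (ih c _ rfl fun _ _ => rfl)
  -- (E1) with the primitive `F = Q·C(j+1,k;β,g+1)`
  have hf_band : IsSemialgebraicFunOn ℚ
      (KZlog.band (KZ.openOrderedSimplex 1) (fun _ : Fin 1 → ℝ => (0 : ℝ)) (fun y : Fin 1 → ℝ => y (Fin.last 0)))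
      (fun z => (q : ℝ) * cc j k β (g + 2) z + (c : ℝ) * cc j k β (g + 1) z) :=
    IsSemialgebraicFunOn.add_holds (cc_sa_band q j k β (g + 2)) (cc_sa_band c j k β (g + 1))
  have hcont : ∀ y ∈ KZ.openOrderedSimplex 1,
      ContinuousOn (fun t => (Q : ℝ) * cc (j + 1) k β (g + 1) (Fin.snoc y t)) (Icc 0 (y (Fin.last 0))) := by
    intro y hy
    obtain ⟨hy0, hy1⟩ := (mem_simplex_one_iff y).1 hy
    have e : (fun t => (Q : ℝ) * cc (j + 1) k β (g + 1) (Fin.snoc y t)) =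
        fun t => (Q : ℝ) * (t ^ (j + 1) * (1 - y 0) ^ k / (y 0 ^ β * (1 - t) ^ (g + 1))) :=
      funext fun t => by rw [cc_snoc]
    rw [e]
    refine continuousOn_const.mul (ContinuousOn.div₀ (by fun_prop) (by fun_prop) fun t ht => ?_)
    have ht1 : t < 1 := lt_of_le_of_lt ht.2 hy1
    exact mul_ne_zero (pow_ne_zero _ hy0.ne') (pow_ne_zero _ (sub_pos.2 ht1).ne')
  have hder : ∀ y ∈ KZ.openOrderedSimplex 1, ∀ t ∈ Ioo 0 (y (Fin.last 0)),
      HasDerivAt (fun s => (Q : ℝ) * cc (j + 1) k β (g + 1) (Fin.snoc y s))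
        ((fun z => (q : ℝ) * cc j k β (g + 2) z + (c : ℝ) * cc j k β (g + 1) z) (Fin.snoc y t)) t := by
    intro y hy t ht
    obtain ⟨hy0, hy1⟩ := (mem_simplex_one_iff y).1 hy
    have ht1 : t < 1 := lt_trans ht.2 hy1
    have h1t : (1 : ℝ) - t ≠ 0 := (sub_pos.2 ht1).ne'
    have hy0' : y 0 ≠ 0 := hy0.ne'
    have e : (fun s => (Q : ℝ) * cc (j + 1) k β (g + 1) (Fin.snoc y s)) =
        fun s => s ^ (j + 1) / (1 - s) ^ (g + 1) * ((Q : ℝ) * (1 - y 0) ^ k / y 0 ^ β) := by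
      funext s; rw [cc_snoc, div_mul_div_comm, mul_div_assoc']; congr 1 <;> ring
    rw [e]
    show HasDerivAt _ ((q : ℝ) * cc j k β (g + 2) (Fin.snoc y t) + (c : ℝ) * cc j k β (g + 1) (Fin.snoc y t)) t
    rw [cc_snoc, cc_snoc]
    have h := ((hasDerivAt_pow (j + 1) t).fun_div (((hasDerivAt_id' t).const_sub 1).fun_pow (g + 1))
      (pow_ne_zero _ h1t)).mul_const ((Q : ℝ) * (1 - y 0) ^ k / y 0 ^ β)
    refine h.congr_deriv ?_
    simp only [Nat.add_sub_cancel, Nat.cast_add, Nat.cast_one, hc, hQ]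
    push_cast
    have hg1' : (g : ℝ) + 1 ≠ 0 := by positivity
    field_simp
    ring
  obtain ⟨r', hd', hi', hrel⟩ :=
    nl_two hf_band (cc_sa_band Q (j + 1) k β (g + 1)) hcont hder (repTwo _ hf_sa hf_int) rfl (fun _ _ => rfl)
  -- rung 1: the boundary integrand is the polynomial `Q·y^{j+1-β}(1-y)^{k-g-1}`
  obtain ⟨e, he⟩ := Nat.exists_eq_add_of_le hj
  obtain ⟨e', he'⟩ := Nat.exists_eq_add_of_le (by omega : g + 1 ≤ k)
  have hi'' : EqOn r'.integrand (fun t => MvPolynomial.aeval t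
      (MvPolynomial.C Q * MvPolynomial.X 0 ^ e * (MvPolynomial.C 1 - MvPolynomial.X 0) ^ e') /
      ((∏ i, t i ^ (0 : Fin 1 → ℕ) i) * (∏ i, (1 - t i) ^ (0 : Fin 1 → ℕ) i) *
        ∏ i, ∏ i', if i < i' then (t i - t i') ^ (0 : Fin 1 → Fin 1 → ℕ) i i' else 1)) r'.domain := by
    intro t ht
    rw [hd'] at ht
    obtain ⟨ht0, ht1⟩ := (mem_simplex_one_iff t).1 ht
    rw [hi']
    show (Q : ℝ) * cc (j + 1) k β (g + 1) (Fin.snoc t (t (Fin.last 0))) -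
        (Q : ℝ) * cc (j + 1) k β (g + 1) (Fin.snoc t 0) = _
    rw [cc_snoc, cc_snoc, show (Fin.last 0 : Fin 1) = 0 from rfl]
    simp only [Pi.zero_apply, pow_zero, Finset.prod_const_one, mul_one, Fin.prod_univ_one,
      lt_self_iff_false, if_false, div_one, map_mul, map_pow, map_sub, MvPolynomial.aeval_C,
      MvPolynomial.aeval_X, eq_ratCast, map_one, ne_eq, Nat.add_one_ne_zero,
      not_false_eq_true, zero_pow, zero_mul, zero_div, mul_zero, sub_zero]
    rw [he, he', pow_add, pow_add]
    have ht0' : t 0 ≠ 0 := ht0.ne'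
    have ht1' : (1 : ℝ) - t 0 ≠ 0 := (sub_pos.2 ht1).ne'
    rw [← mul_div_assoc, div_eq_iff (mul_ne_zero (pow_ne_zero _ ht0') (pow_ne_zero _ ht1'))]
    ring
  obtain ⟨m, hm, hrel'⟩ := gz_one r' _ 0 0 0 hd' hi''
  refine ⟨m, closure_zero_le_two (AddSubgroup.subset_closure hm), ?_⟩
  have := add_mem hrel hrel'
  rwa [sub_add_sub_cancel] at this

/-- (E2) transports membership between a class and its dual: `C(j,k;β,γ) = C(k,j;γ,β) ∘ σ` -/
theorem cc_dual_mem (q : ℚ) {j k β γ : ℕ} (hj : β ≤ j + 1) (hk : γ ≤ k + 1)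
    (h : ∃ m ∈ AddSubgroup.closure (wordGensLE 2), KZ.of (ccRep q k j γ β hk hj) - m ∈ KZ.relations)
    (r : KZ.IntegralRep 2) (hd : r.domain = KZ.openOrderedSimplex 2)
    (hi : EqOn r.integrand (fun z => (q : ℝ) * cc j k β γ z) r.domain) :
    ∃ m ∈ AddSubgroup.closure (wordGensLE 2), KZ.of r - m ∈ KZ.relations := by
  have hdual : KZ.of r - KZ.of (ccRep q k j γ β hk hj) ∈ KZ.relations :=
    dualityTwo r _ hd rfl fun z hz => by
      rw [hi (by rw [hd]; exact hz)]
      show (q : ℝ) * cc j k β γ z = (q : ℝ) * cc k j γ β (spΦ z)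
      simp only [cc, spΦ_zero, spΦ_one, sub_sub_cancel]
      ring
  obtain ⟨m, hm, hrel⟩ := h
  exact ⟨m, hm, by have := add_mem hdual hrel; rwa [sub_add_sub_cancel] at this⟩

/-- the classes with `β ≤ 1`: induction on `γ` by the two-term step, from the bases of §16 -/
theorem cc_mem_beta_le_one (j k β : ℕ) (hβ : β ≤ 1) (hj : β ≤ j + 1) :
    ∀ (γ : ℕ), γ ≤ k + 1 → ∀ (q : ℚ) (r : KZ.IntegralRep 2), r.domain = KZ.openOrderedSimplex 2 →
      EqOn r.integrand (fun z => (q : ℝ) * cc j k β γ z) r.domain →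
      ∃ m ∈ AddSubgroup.closure (wordGensLE 2), KZ.of r - m ∈ KZ.relations
  | 0, _, q, r, hd, hi => by
      obtain ⟨m, hm, h⟩ := cc_gamma_zero q j k β hj r hd hi
      exact ⟨m, closure_zero_le_two hm, h⟩
  | 1, _, q, r, hd, hi => cc_le_one q j k β 1 hβ le_rfl r hd hi
  | g + 2, hk, q, r, hd, hi =>
      cc_gamma_step q hj hk (fun q' r' hd' hi' => cc_mem_beta_le_one j k β hβ hj (g + 1) (by omega) q' r' hd' hi') r hd hi

/-- all classes: induction on `β`, the step dualised by (E2) -/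
theorem cc_mem (j k γ : ℕ) (hk : γ ≤ k + 1) :
    ∀ (β : ℕ), β ≤ j + 1 → ∀ (q : ℚ) (r : KZ.IntegralRep 2), r.domain = KZ.openOrderedSimplex 2 →
      EqOn r.integrand (fun z => (q : ℝ) * cc j k β γ z) r.domain →
      ∃ m ∈ AddSubgroup.closure (wordGensLE 2), KZ.of r - m ∈ KZ.relations
  | 0, hj, q, r, hd, hi => cc_mem_beta_le_one j k 0 (Nat.zero_le 1) hj γ hk q r hd hi
  | 1, hj, q, r, hd, hi => cc_mem_beta_le_one j k 1 le_rfl hj γ hk q r hd hi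
  | b + 2, hj, q, r, hd, hi => by
      refine cc_dual_mem q hj hk ?_ r hd hi
      refine cc_gamma_step q hk hj (fun q' r' hd' hi' => ?_) _ rfl fun _ _ => rfl
      exact cc_dual_mem q' hk (by omega : b + 1 ≤ j + 1)
        (cc_mem j k γ hk (b + 1) (by omega) q' _ rfl fun _ _ => rfl) r' hd' hi'

/-- **ALL CORNER CLASSES, DECIDED.**  Every class `q·C(j,k;β,γ) = q·t₁^j(1-t₀)^k/(t₀^β(1-t₁)^γ)` with `β ≤ j+1`, `γ ≤ k+1`
(equivalently: absolutely convergent on `Δ₂`, §16 S2) lies in the weight-`≤ 2` word span `ℚ·[pt] + ℚ·[Δ₁,ω_ε] + ℚ·[Δ₂,ω₀ω₁]`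
modulo `KZ.relations`, by finitely many rule-1b / (E1) / (E2) moves between absolutely convergent representations.
[Kontsevich–Zagier 2001 §1.2; this file §15–§16] -/
theorem cc_all (q : ℚ) {j k β γ : ℕ} (hj : β ≤ j + 1) (hk : γ ≤ k + 1) (r : KZ.IntegralRep 2)
    (hd : r.domain = KZ.openOrderedSimplex 2) (hi : EqOn r.integrand (fun z => (q : ℝ) * cc j k β γ z) r.domain) :
    ∃ m ∈ AddSubgroup.closure (wordGensLE 2), KZ.of r - m ∈ KZ.relations :=
  cc_mem j k γ hk β hj q r hd hi

end CornerClassesAll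
/-! ## §20  THE CORNER LAYER OF RUNG 2 (gen 10): `[Δ₂, P/(t₀^β(1-t₁)^γ)]` for EVERY `P ∈ ℚ[t₀,t₁]` vanishing to order `≥ β-1`
at the corner `(0,0)` and to order `≥ γ-1` at the corner `(1,1)`.  The monomial classes
`M(a,b,c,d;β,γ) = t₀^a t₁^b (1-t₀)^c (1-t₁)^d/(t₀^β(1-t₁)^γ)` (absolutely convergent iff `β ≤ a+b+1`, `γ ≤ c+d+1`) reduce to corner classes
by rule-1b peeling (`t₀ = 1 - (1-t₀)`, `1-t₁ = 1 - t₁`) and cancellation; the PARTITION OF UNITY `1 = (t₀ + (1-t₀))^N`,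
`N = (β-1)+(γ-1)`, splits `P/(t₀^β(1-t₁)^γ)` into finitely many absolutely convergent monomial classes — the terms with `i ≥ β-1`
read `P` in the basis `(1-t₀)^u₀(1-t₁)^u₁` (safe at `(1,1)`), the others in the basis `t₀^s₀t₁^s₁` (safe at `(0,0)`): the comaximality
`I^m ∩ J^n = I^m·J^n` of the two corner ideals made explicit and CONVERGENT TERMWISE (every piece of every split is absolutely integrable). -/

section CornerLayer
open Literature.ModelTheory.ExponentialFields (IsSemialgebraic)
/-- the monomial class `M(a,b,c,d;β,γ)(t₀,t₁) = t₀^a t₁^b (1-t₀)^c (1-t₁)^d / (t₀^β (1-t₁)^γ)` -/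
def mc (a b c d β γ : ℕ) (z : Fin 2 → ℝ) : ℝ :=
  z 0 ^ a * z 1 ^ b * (1 - z 0) ^ c * (1 - z 1) ^ d / (z 0 ^ β * (1 - z 1) ^ γ)

/-- Auxiliary step `mc_sa`. [bookkeeping] -/
theorem mc_sa (q : ℚ) (a b c d β γ : ℕ) :
    IsSemialgebraicFunOn ℚ (KZ.openOrderedSimplex 2) (fun z => (q : ℝ) * mc a b c d β γ z) := by
  refine (isSemialgebraicFunOn_aeval_div_aeval (KZ.isSemialgebraic_openOrderedSimplex 2)
    (MvPolynomial.C q * (MvPolynomial.X 0 ^ a * MvPolynomial.X 1 ^ b * (MvPolynomial.C 1 - MvPolynomial.X 0) ^ c *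
      (MvPolynomial.C 1 - MvPolynomial.X 1) ^ d))
    (MvPolynomial.X 0 ^ β * (MvPolynomial.C 1 - MvPolynomial.X 1) ^ γ) fun z hz => ?_).congr fun z hz => ?_
  · obtain ⟨h1, h10, h0⟩ := (mem_simplex_two_iff z).1 hz
    have : (1 : ℝ) - z 1 ≠ 0 := by linarith
    have : z 0 ≠ 0 := (h1.trans h10).ne'
    simp only [map_mul, map_pow, map_sub, MvPolynomial.aeval_X, map_one]
    positivity
  · simp only [map_mul, map_pow, map_sub, MvPolynomial.aeval_X, MvPolynomial.aeval_C, eq_ratCast, map_one, mc,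
      mul_div_assoc']

/-- Auxiliary step `mc_nonneg`. [bookkeeping] -/
theorem mc_nonneg (a b c d β γ : ℕ) {z : Fin 2 → ℝ} (hz : z ∈ KZ.openOrderedSimplex 2) : 0 ≤ mc a b c d β γ z := by
  obtain ⟨h1, h10, h0⟩ := (mem_simplex_two_iff z).1 hz
  have : 0 < 1 - z 1 := by linarith
  have : 0 ≤ 1 - z 0 := by linarith
  have : 0 < z 0 := h1.trans h10
  unfold mc
  positivity

/-- domination: for `β ≤ a+b+1`, `γ ≤ c+d+1` the monomial class is bounded by `ω₀ω₁` on `Δ₂` -/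
theorem mc_le_spW {a b c d β γ : ℕ} (h0 : β ≤ a + b + 1) (h1 : γ ≤ c + d + 1) {z : Fin 2 → ℝ}
    (hz : z ∈ KZ.openOrderedSimplex 2) : mc a b c d β γ z ≤ spW z := by
  obtain ⟨hz1, h10, hz0⟩ := (mem_simplex_two_iff z).1 hz
  have hz0' : 0 < z 0 := hz1.trans h10
  have h1' : 0 < 1 - z 1 := by linarith
  have h0' : 0 ≤ 1 - z 0 := by linarith
  have hA : z 0 ^ a * z 1 ^ b * z 0 ≤ z 0 ^ β :=
    calc z 0 ^ a * z 1 ^ b * z 0 ≤ z 0 ^ a * z 0 ^ b * z 0 := by gcongr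
      _ = z 0 ^ (a + b + 1) := by ring
      _ ≤ z 0 ^ β := pow_le_pow_of_le_one hz0'.le hz0.le h0
  have hB : (1 - z 0) ^ c * (1 - z 1) ^ d * (1 - z 1) ≤ (1 - z 1) ^ γ :=
    calc (1 - z 0) ^ c * (1 - z 1) ^ d * (1 - z 1) ≤ (1 - z 1) ^ c * (1 - z 1) ^ d * (1 - z 1) := by gcongr
      _ = (1 - z 1) ^ (c + d + 1) := by ring
      _ ≤ (1 - z 1) ^ γ := pow_le_pow_of_le_one h1'.le (by linarith) h1
  unfold mc spW
  rw [div_le_div_iff₀ (by positivity) (by positivity), one_mul]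
  calc z 0 ^ a * z 1 ^ b * (1 - z 0) ^ c * (1 - z 1) ^ d * (z 0 * (1 - z 1))
      = (z 0 ^ a * z 1 ^ b * z 0) * ((1 - z 0) ^ c * (1 - z 1) ^ d * (1 - z 1)) := by ring
    _ ≤ z 0 ^ β * (1 - z 1) ^ γ := mul_le_mul hA hB (by positivity) (by positivity)

/-- every monomial class with `β ≤ a+b+1`, `γ ≤ c+d+1` is absolutely integrable on `Δ₂` -/
theorem mc_integrableOn (q : ℚ) {a b c d β γ : ℕ} (h0 : β ≤ a + b + 1) (h1 : γ ≤ c + d + 1) :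
    IntegrableOn (fun z => (q : ℝ) * mc a b c d β γ z) (KZ.openOrderedSimplex 2) := by
  refine integrableOn_of_dominated (KZ.isSemialgebraic_openOrderedSimplex 2) (mc_sa q a b c d β γ)
    (spW_integrableOn.const_mul |(q : ℝ)|) fun z hz => ?_
  rw [abs_mul, abs_of_nonneg (mc_nonneg a b c d β γ hz)]
  exact mul_le_mul_of_nonneg_left (mc_le_spW h0 h1 hz) (abs_nonneg _)

/-- the monomial class as a representation on `Δ₂` -/
def mcRep (q : ℚ) (a b c d β γ : ℕ) (h0 : β ≤ a + b + 1) (h1 : γ ≤ c + d + 1) : KZ.IntegralRep 2 :=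
  repTwo (fun z => (q : ℝ) * mc a b c d β γ z) (mc_sa q a b c d β γ) (mc_integrableOn q h0 h1)

end CornerLayer
end Summit.KontsevichZagierPeriods.RootDecompZetaThreeFrontier.WordLayer
end
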